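import Summits.HubbardSuperconductivity.HubbardSuperconductivity.Theorems.LiebTwinNoOnsiteODLROProjectedAddition
import Literature.MathematicalPhysics.QuantumLattice.HubbardSzSectorLadder

/-!
# Crux `NoOnsiteODLRO` (stmt-HubbardSuperconductivity-0933), large-`U` shadow, part 2/3:
# the projected-addition step and the kinetic pair window `E(N) - E(N-2) ≤ 144|t|/√δ`

Ground states exist in every spin sector `(a, b)` (`sector_groundState` of the tree on the coordinate
subspace `szSector (a+b) ((a-b)/2)`). THE ADDITION STEP: for an eigenvector `φ` of `H = hamiltonian G t U`
in the sector `(a, b)`, `a + b < |Λ|`, averaging the projected additions `A_x φ = c†_{xτ}(1-n_{xτ'}) φ`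
over the sites (total weight `≥ (|Λ|-a-b)‖φ‖²`, total excess energy
`Σ_x Re⟨A_xφ,[H,A_x]φ⟩ ≤ (2Δ+1)8|t| ‖φ‖ Σ_x‖A_xφ‖`) gives
`E(a',b') ≤ E(a,b) + (2Δ+1)·8|t|·(|Λ|/(|Λ|-a-b))^{1/2}` for `(a',b') ∈ {(a+1,b),(a,b+1)}`, uniformly in
`U`. On the torus `(ℤ/Lℤ)²` (`Δ = 4`) two steps give
`E(2m+2, 0) ≤ E(2m, 0) + 144|t| (L²/(L²-2m-1))^{1/2}`: an `L`-uniform, `U`-INDEPENDENT upper bound on the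
pair chemical potential `2μ₋ = E(N) - E(N-2)`, complementing the landed `E(N) - E(N-2) ≤ U` (Yang) and
`E(N-2) ≤ E(N) + 8|t|` (`minEnergyOn_szSector_le_add_two`). Ruelle (1969) §3.4; Tasaki (2020) §2.1–2.2.
All folklore bookkeeping.
-/

noncomputable section

namespace Summit.HubbardSuperconductivity.NoOnsiteODLRO.LargeU

open Matrix Finset
open Literature.Probability.LatticeModels Literature.MathematicalPhysics.QuantumLattice
open scoped ComplexOrder Matrix.Norms.L2Operator

/-! ### The addition step (ground states of a general spin sector: `upDownSector_groundState`) -/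

section Addition

variable {Λ : Type*} [LinearOrder Λ] [Fintype Λ] (G : SimpleGraph Λ) [DecidableRel G.Adj]

omit [LinearOrder Λ] in
/-- Discrete Cauchy–Schwarz: `(Σ_x f x)² ≤ |Λ| · Σ_x (f x)²`. [folklore] -/
theorem sq_sum_le_card_mul_sum_sq (f : Λ → ℝ) :
    (∑ x : Λ, f x) ^ 2 ≤ (Fintype.card Λ : ℝ) * ∑ x : Λ, f x ^ 2 := by
  have h := Finset.sum_mul_sq_le_sq_mul_sq Finset.univ f fun _ => (1 : ℝ)
  simp only [mul_one, one_pow, Finset.sum_const, Finset.card_univ, nsmul_eq_mul] at h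
  linarith [h]

/-- **The addition step.** `H = hamiltonian G t U` on a graph of maximal degree `≤ Δ`; `φ ≠ 0` an
EIGENVECTOR of `H` (`H φ = E' φ`) in the sector `(a, b)` with `a + b < |Λ|`; the projected additions
`A_x φ = c†_{xτ}(1 - n_{xτ'}) φ` (`τ' ≠ τ`) all lie in a sector on which `E ‖w‖² ≤ Re⟨w, H w⟩`. Then
`E ≤ E' + (2Δ+1)·8|t|·(|Λ|/(|Λ|-a-b))^{1/2}`,
UNIFORMLY IN `U` (adding an electron into an empty site costs only kinetic energy). Proof: average
the trial vectors `A_xφ` — total weight `W ≥ (|Λ|-a-b)‖φ‖²` (`sum_weight_projCreation_ge`), total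
excess energy `Σ_x Re⟨A_xφ, [H, A_x]φ⟩ ≤ (2Δ+1)8|t| ‖φ‖ Σ_x ‖A_xφ‖ ≤ (2Δ+1)8|t| ‖φ‖ (|Λ| W)^{1/2}`.
Ruelle (1969) §3.4 (classical analogue); Tasaki (2020) §2.1. [folklore] -/
theorem addition_step {Δ : ℕ} (hΔ : ∀ x : Λ, (Finset.univ.filter (G.Adj x)).card ≤ Δ) (t U : ℝ)
    {τ τ' : Fin 2} (hne : τ' ≠ τ) {a b a' b' : ℕ} {φ : Fock (Orb Λ)} (hφ : IsInSector a b φ)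
    (hφ0 : φ ≠ 0) (hab : a + b < Fintype.card Λ) {E' : ℝ}
    (hHφ : hamiltonian G t U *ᵥ φ = ((E' : ℝ) : ℂ) • φ)
    (hup : ∀ x : Λ, IsInSector a' b' ((creation (orb x τ) - creation (orb x τ) * numberOp x τ') *ᵥ φ))
    {E : ℝ} (hE : ∀ w : Fock (Orb Λ), IsInSector a' b' w →
      E * (star w ⬝ᵥ w).re ≤ (star w ⬝ᵥ (hamiltonian G t U *ᵥ w)).re) :
    E - E' ≤ ((2 * Δ + 1 : ℕ) : ℝ) * (8 * |t|) *
      Real.sqrt ((Fintype.card Λ : ℝ) / ((Fintype.card Λ : ℝ) - (a + b))) := by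
  set H := hamiltonian G t U with hH
  set K : ℝ := ((2 * Δ + 1 : ℕ) : ℝ) * (8 * |t|) with hK
  set A : Λ → Matrix (Finset (Orb Λ)) (Finset (Orb Λ)) ℂ :=
    fun x => creation (orb x τ) - creation (orb x τ) * numberOp x τ' with hA
  set w : Λ → Fock (Orb Λ) := fun x => A x *ᵥ φ with hw
  set f : Λ → ℝ := fun x => eucNorm (w x) with hf
  set W : ℝ := ∑ x, f x ^ 2 with hWdef
  have hK0 : 0 ≤ K := by positivity
  have hf0 : ∀ x, 0 ≤ f x := fun x => eucNorm_nonneg _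
  have hφpos : 0 < (star φ ⬝ᵥ φ).re := (Complex.pos_iff.mp (dotProduct_star_self_pos_iff.2 hφ0)).1
  have hcard : 0 < (Fintype.card Λ : ℝ) - (a + b) := by
    have : ((a + b : ℕ) : ℝ) < (Fintype.card Λ : ℝ) := by exact_mod_cast hab
    push_cast at this
    linarith
  -- total weight
  have hW : ((Fintype.card Λ : ℝ) - (a + b)) * (star φ ⬝ᵥ φ).re ≤ W := by
    have h := sum_weight_projCreation_ge hφ hne
    simp only [hWdef, hf, eucNorm_sq]
    exact h
  have hWpos : 0 < W := lt_of_lt_of_le (mul_pos hcard hφpos) hW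
  -- energy of each trial vector: `Re⟨w_x, H w_x⟩ = E' ‖w_x‖² + Re⟨w_x, [H, A_x] φ⟩`
  have hen : ∀ x, (star (w x) ⬝ᵥ (H *ᵥ w x)).re =
      E' * f x ^ 2 + (star (w x) ⬝ᵥ ((H * A x - A x * H) *ᵥ φ)).re := by
    intro x
    have h1 : H *ᵥ w x = (H * A x - A x * H) *ᵥ φ + ((E' : ℝ) : ℂ) • w x := by
      show H *ᵥ (A x *ᵥ φ) = (H * A x - A x * H) *ᵥ φ + ((E' : ℝ) : ℂ) • (A x *ᵥ φ)
      rw [mulVec_mulVec, sub_mulVec, show (A x * H) *ᵥ φ = A x *ᵥ (H *ᵥ φ) from (mulVec_mulVec _ _ _).symm,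
        hHφ, mulVec_smul]
      abel
    rw [h1, dotProduct_add, dotProduct_smul, Complex.add_re, smul_eq_mul, Complex.re_ofReal_mul,
      hf, eucNorm_sq]
    ring
  -- the commutator part: `Re⟨w_x, [H,A_x]φ⟩ ≤ K ‖w_x‖ ‖φ‖`
  have hC : ∀ x, (star (w x) ⬝ᵥ ((H * A x - A x * H) *ᵥ φ)).re ≤ K * f x * eucNorm φ := by
    intro x
    refine (Complex.re_le_norm _).trans ((norm_star_dotProduct_le _ _).trans ?_)
    have h1 : eucNorm ((H * A x - A x * H) *ᵥ φ) ≤ K * eucNorm φ :=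
      (eucNorm_mulVec_le _ _).trans (mul_le_mul_of_nonneg_right
        (norm_commutator_hamiltonian_projCreation_le G hΔ t U x hne) (eucNorm_nonneg _))
    calc eucNorm (w x) * eucNorm ((H * A x - A x * H) *ᵥ φ)
        ≤ eucNorm (w x) * (K * eucNorm φ) := mul_le_mul_of_nonneg_left h1 (eucNorm_nonneg _)
      _ = K * f x * eucNorm φ := by simp only [hf]; ring
  -- variational bound on each trial vector, summed
  have hvar : ∀ x, E * f x ^ 2 ≤ (star (w x) ⬝ᵥ (H *ᵥ w x)).re := fun x => by
    have h := hE (w x) (hup x)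
    rwa [← eucNorm_sq] at h
  have hsum : E * W ≤ E' * W + K * eucNorm φ * ∑ x, f x := by
    have h1 : ∑ x, E * f x ^ 2 ≤ ∑ x, (E' * f x ^ 2 + K * f x * eucNorm φ) :=
      Finset.sum_le_sum fun x _ => by linarith [hvar x, hen x, hC x]
    rw [← Finset.mul_sum, Finset.sum_add_distrib, ← Finset.mul_sum] at h1
    have h2 : ∑ x, K * f x * eucNorm φ = K * eucNorm φ * ∑ x, f x := by
      rw [Finset.mul_sum]; exact Finset.sum_congr rfl fun x _ => by ring
    linarith [h1, h2]
  -- Cauchy–Schwarz on `Σ_x f x` and the conclusion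
  have hCS : (∑ x, f x) ^ 2 ≤ (Fintype.card Λ : ℝ) * W := sq_sum_le_card_mul_sum_sq f
  have hS0 : 0 ≤ ∑ x, f x := Finset.sum_nonneg fun x _ => hf0 x
  have hφn : eucNorm φ ^ 2 = (star φ ⬝ᵥ φ).re := eucNorm_sq φ
  have hφn0 : 0 ≤ eucNorm φ := eucNorm_nonneg φ
  have hsqrt0 : 0 ≤ Real.sqrt ((Fintype.card Λ : ℝ) / ((Fintype.card Λ : ℝ) - (a + b))) :=
    Real.sqrt_nonneg _
  rcases le_or_gt (E - E') 0 with hneg | hposE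
  · exact hneg.trans (mul_nonneg hK0 hsqrt0)
  · have h1 : (E - E') * W ≤ K * eucNorm φ * ∑ x, f x := by linarith
    have h2 : ((E - E') * W) ^ 2 ≤ (K * eucNorm φ * ∑ x, f x) ^ 2 :=
      pow_le_pow_left₀ (mul_nonneg hposE.le hWpos.le) h1 2
    have h3 : (K * eucNorm φ * ∑ x, f x) ^ 2 ≤ K ^ 2 * (star φ ⬝ᵥ φ).re * ((Fintype.card Λ : ℝ) * W) := by
      rw [show (K * eucNorm φ * ∑ x, f x) ^ 2 = K ^ 2 * eucNorm φ ^ 2 * (∑ x, f x) ^ 2 by ring, hφn]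
      exact mul_le_mul_of_nonneg_left hCS (by positivity)
    -- divide by `W > 0`: `(E-E')² W ≤ K² ‖φ‖² |Λ|`
    have h4 : (E - E') ^ 2 * W ≤ K ^ 2 * (star φ ⬝ᵥ φ).re * (Fintype.card Λ : ℝ) := by
      have : (E - E') ^ 2 * W * W ≤ K ^ 2 * (star φ ⬝ᵥ φ).re * (Fintype.card Λ : ℝ) * W := by
        nlinarith [h2, h3]
      exact le_of_mul_le_mul_right this hWpos
    -- use `W ≥ (|Λ| - a - b) ‖φ‖²` and divide by `‖φ‖² > 0`
    have h5 : (E - E') ^ 2 * (((Fintype.card Λ : ℝ) - (a + b)) * (star φ ⬝ᵥ φ).re) ≤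
        K ^ 2 * (star φ ⬝ᵥ φ).re * (Fintype.card Λ : ℝ) :=
      (mul_le_mul_of_nonneg_left hW (sq_nonneg _)).trans h4
    have h6 : ((E - E') ^ 2 * ((Fintype.card Λ : ℝ) - (a + b))) * (star φ ⬝ᵥ φ).re ≤
        (K ^ 2 * (Fintype.card Λ : ℝ)) * (star φ ⬝ᵥ φ).re := by nlinarith [h5]
    have h7 : (E - E') ^ 2 * ((Fintype.card Λ : ℝ) - (a + b)) ≤ K ^ 2 * (Fintype.card Λ : ℝ) :=
      le_of_mul_le_mul_right h6 hφpos
    -- take square roots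
    have h8 : (E - E') ^ 2 ≤ K ^ 2 * ((Fintype.card Λ : ℝ) / ((Fintype.card Λ : ℝ) - (a + b))) := by
      rw [mul_div_assoc', le_div_iff₀ hcard]
      exact h7
    have h9 : E - E' = Real.sqrt ((E - E') ^ 2) := (Real.sqrt_sq hposE.le).symm
    rw [h9]
    calc Real.sqrt ((E - E') ^ 2)
        ≤ Real.sqrt (K ^ 2 * ((Fintype.card Λ : ℝ) / ((Fintype.card Λ : ℝ) - (a + b)))) :=
          Real.sqrt_le_sqrt h8
      _ = K * Real.sqrt ((Fintype.card Λ : ℝ) / ((Fintype.card Λ : ℝ) - (a + b))) := by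
          rw [Real.sqrt_mul (sq_nonneg K), Real.sqrt_sq hK0]

end Addition

/-! ### The torus: `E(2m+2, 0) ≤ E(2m, 0) + 144|t| (L²/(L²-2m-1))^{1/2}` -/

section Torus

open Summit.HubbardSuperconductivity.HubbardSuperconductivity.Theorems.EnslavedA1g

variable {Λ : Type*} [LinearOrder Λ] [Fintype Λ]

/-- `c†_{x↑}(1 - n_{x↓})` maps the sector `(a, b)` into `(a + 1, b)`. [folklore] -/
theorem isInSector_projCreation_up {a b : ℕ} {φ : Fock (Orb Λ)} (hφ : IsInSector a b φ) (x : Λ) :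
    IsInSector (a + 1) b ((creation (orb x 0) - creation (orb x 0) * numberOp x 1) *ᵥ φ) := by
  have hc : PairChirality.Shifts 1 0 (creation (orb x 0) : Matrix (Finset (Orb Λ)) (Finset (Orb Λ)) ℂ) :=
    shifts_creation_up x
  have hn : PairChirality.Shifts 0 0 (numberOp x 1 : Matrix (Finset (Orb Λ)) (Finset (Orb Λ)) ℂ) := by
    have h := (shifts_creation_down (Λ := Λ) x).mul (PairChirality.shifts_annihilation_down (Λ := Λ) x)
    rw [show (numberOp x 1 : Matrix (Finset (Orb Λ)) (Finset (Orb Λ)) ℂ) =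
      creation (orb x 1) * annihilation (orb x 1) from rfl]
    simpa using h
  have hM : PairChirality.Shifts 1 0
      (creation (orb x 0) - creation (orb x 0) * numberOp x 1 : Matrix (Finset (Orb Λ)) (Finset (Orb Λ)) ℂ) := by
    have h := hc.mul hn
    simp only [add_zero] at h
    exact hc.sub h
  exact isInSector_mulVec_of_shifts hM (by push_cast; ring) (by simp) hφ

/-- `c†_{x↓}(1 - n_{x↑})` maps the sector `(a, b)` into `(a, b + 1)`. [folklore] -/
theorem isInSector_projCreation_down {a b : ℕ} {φ : Fock (Orb Λ)} (hφ : IsInSector a b φ) (x : Λ) :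
    IsInSector a (b + 1) ((creation (orb x 1) - creation (orb x 1) * numberOp x 0) *ᵥ φ) := by
  have hc : PairChirality.Shifts 0 1 (creation (orb x 1) : Matrix (Finset (Orb Λ)) (Finset (Orb Λ)) ℂ) :=
    shifts_creation_down x
  have hn : PairChirality.Shifts 0 0 (numberOp x 0 : Matrix (Finset (Orb Λ)) (Finset (Orb Λ)) ℂ) := by
    have h := (shifts_creation_up (Λ := Λ) x).mul (PairChirality.shifts_annihilation_up (Λ := Λ) x)
    rw [show (numberOp x 0 : Matrix (Finset (Orb Λ)) (Finset (Orb Λ)) ℂ) =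
      creation (orb x 0) * annihilation (orb x 0) from rfl]
    simpa using h
  have hM : PairChirality.Shifts 0 1
      (creation (orb x 1) - creation (orb x 1) * numberOp x 0 : Matrix (Finset (Orb Λ)) (Finset (Orb Λ)) ℂ) := by
    have h := hc.mul hn
    simp only [add_zero] at h
    exact hc.sub h
  exact isInSector_mulVec_of_shifts hM (by simp) (by push_cast; ring) hφ

variable (G : SimpleGraph Λ) [DecidableRel G.Adj]

/-- **One projected addition costs at most `(2Δ+1)·8|t|·(|Λ|/(|Λ|-a-b))^{1/2}` in sector energy**,
uniformly in `U`: `minEnergyOn H K(a', b') ≤ minEnergyOn H K(a, b) + …` for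
`(a', b') ∈ {(a+1, b), (a, b+1)}`, `a + b < |Λ|`, `K(a,b) = szSector (a+b) ((a-b)/2)`. [folklore] -/
theorem minEnergyOn_addOne_le {Δ : ℕ} (hΔ : ∀ x : Λ, (Finset.univ.filter (G.Adj x)).card ≤ Δ)
    (t U : ℝ) (σ : Fin 2) {a b : ℕ} (hab : a + b < Fintype.card Λ) :
    (hamiltonian G t U).minEnergyOn
        (szSector ((if σ = 0 then a + 1 else a) + (if σ = 0 then b else b + 1))
          ((((if σ = 0 then a + 1 else a : ℕ) : ℝ) - (if σ = 0 then b else b + 1 : ℕ)) / 2)) ≤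
      (hamiltonian G t U).minEnergyOn (szSector (a + b) (((a : ℝ) - b) / 2)) +
        ((2 * Δ + 1 : ℕ) : ℝ) * (8 * |t|) *
          Real.sqrt ((Fintype.card Λ : ℝ) / ((Fintype.card Λ : ℝ) - (a + b))) := by
  set a' : ℕ := if σ = 0 then a + 1 else a with ha'
  set b' : ℕ := if σ = 0 then b else b + 1 with hb'
  set H := hamiltonian G t U with hH
  have hHerm : H.IsHermitian := LiebThm1.hamiltonian_isHermitian G t U
  have ha : a ≤ Fintype.card Λ := by omega
  have hb : b ≤ Fintype.card Λ := by omega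
  -- a ground state of the lower sector
  obtain ⟨φ, hφ, hφ0, hHφ⟩ := (upDownSector_groundState G t U ha hb).1
  set E' : ℝ := H.minEnergyOn (szSector (a + b) (((a : ℝ) - b) / 2)) with hE'
  set E : ℝ := H.minEnergyOn (szSector (a' + b') (((a' : ℝ) - b') / 2)) with hE
  have hEw : ∀ w : Fock (Orb Λ), IsInSector a' b' w →
      E * (star w ⬝ᵥ w).re ≤ (star w ⬝ᵥ (H *ᵥ w)).re := fun w hw =>
    UpperSandwich.minEnergyOn_mul_le_re hHerm _
      ((Summit.HubbardSuperconductivity.HubbardSuperconductivity.Theorems.isInSector_iff_mem_szSector a' b' w).1 hw)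
  suffices h : E - E' ≤ ((2 * Δ + 1 : ℕ) : ℝ) * (8 * |t|) *
      Real.sqrt ((Fintype.card Λ : ℝ) / ((Fintype.card Λ : ℝ) - (a + b))) by linarith
  fin_cases σ
  · -- add an up electron: `(a, b) → (a + 1, b)`
    simp only [Fin.zero_eta, Fin.isValue, if_true] at ha' hb'
    have hup : ∀ x : Λ, IsInSector a' b'
        ((creation (orb x 0) - creation (orb x 0) * numberOp x 1) *ᵥ φ) := fun x => by
      rw [ha', hb']; exact isInSector_projCreation_up hφ x
    exact addition_step G hΔ t U (τ := 0) (τ' := 1) (by decide) hφ hφ0 hab hHφ hup hEw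
  · -- add a down electron: `(a, b) → (a, b + 1)`
    simp only [Fin.mk_one, Fin.isValue, one_ne_zero, if_false] at ha' hb'
    have hup : ∀ x : Λ, IsInSector a' b'
        ((creation (orb x 1) - creation (orb x 1) * numberOp x 0) *ᵥ φ) := fun x => by
      rw [ha', hb']; exact isInSector_projCreation_down hφ x
    exact addition_step G hΔ t U (τ := 1) (τ' := 0) (by decide) hφ hφ0 hab hHφ hup hEw

variable (L : ℕ) [NeZero L]

/-- **Two projected additions on the torus.** For the Hubbard model on `(ℤ/Lℤ)²` (degree `4`) and
`2m + 2 ≤ L²`: `E(2m+2, 0) ≤ E(2m, 0) + 144|t| · (L²/(L² - 2m - 1))^{1/2}`, uniformly in `U` — add an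
up electron into an empty site (`(m,m) → (m+1,m)`), then a down electron (`→ (m+1,m+1)`), each at
cost `≤ 72|t| (L²/#holes)^{1/2}`. This is an `L`-uniform upper bound on the pair chemical potential
`2μ₋ = E(N) - E(N-2) ≤ 144|t|/√δ` at hole density `δ`. [folklore] -/
theorem minEnergyOn_szSector_add_two_le_kinetic (t U : ℝ) {m : ℕ} (hm : 2 * m + 2 ≤ L ^ 2) :
    (hubbardTorus 2 L t U).minEnergyOn (szSector (2 * m + 2) 0) ≤
      (hubbardTorus 2 L t U).minEnergyOn (szSector (2 * m) 0) +
        144 * |t| * Real.sqrt (((L : ℝ) ^ 2) / ((L : ℝ) ^ 2 - (2 * m + 1))) := by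
  have hΔ : ∀ x : FermionTorus 2 L, (Finset.univ.filter ((fermionTorusGraph 2 L).Adj x)).card ≤ 4 :=
    fun x => (SourceGas.card_filter_fermionTorusGraph_adj_le (d := 2) (L := L) x).trans (by norm_num)
  have hcard : Fintype.card (FermionTorus 2 L) = L ^ 2 := card_fermionTorus 2 L
  have hcardR : (Fintype.card (FermionTorus 2 L) : ℝ) = (L : ℝ) ^ 2 := by rw [hcard]; push_cast; ring
  -- step 1: `(m, m) → (m + 1, m)`
  have h1 := minEnergyOn_addOne_le (fermionTorusGraph 2 L) hΔ t U 0 (a := m) (b := m) (by rw [hcard]; omega)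
  -- step 2: `(m + 1, m) → (m + 1, m + 1)`
  have h2 := minEnergyOn_addOne_le (fermionTorusGraph 2 L) hΔ t U 1 (a := m + 1) (b := m)
    (by rw [hcard]; omega)
  simp only [if_true, one_ne_zero, if_false] at h1 h2
  have e0 : szSector (Λ := FermionTorus 2 L) (m + m) (((m : ℝ) - m) / 2) = szSector (2 * m) 0 := by
    congr 1 <;> ring
  have e1 : szSector (Λ := FermionTorus 2 L) (m + 1 + m) ((((m + 1 : ℕ) : ℝ) - (m : ℕ)) / 2) =
      szSector (m + 1 + m) (((m : ℝ) + 1 - m) / 2) := by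
    congr 1; push_cast; ring
  have e2 : szSector (Λ := FermionTorus 2 L) (m + 1 + (m + 1))
      ((((m + 1 : ℕ) : ℝ) - ((m + 1 : ℕ) : ℝ)) / 2) = szSector (2 * m + 2) 0 := by
    congr 1
    · ring
    · push_cast; ring
  rw [e0, e1] at h1
  rw [e1, e2] at h2
  rw [hcardR] at h1 h2
  have hK : ((2 * 4 + 1 : ℕ) : ℝ) * (8 * |t|) = 72 * |t| := by push_cast; ring
  rw [hK] at h1 h2
  change (hamiltonian (fermionTorusGraph 2 L) t U).minEnergyOn _ ≤
    (hamiltonian (fermionTorusGraph 2 L) t U).minEnergyOn _ + _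
  -- the two square roots are each `≤ (L²/(L²-2m-1))^{1/2}`
  have hL2 : (2 * (m : ℝ) + 2) ≤ (L : ℝ) ^ 2 := by
    have h : ((2 * m + 2 : ℕ) : ℝ) ≤ ((L ^ 2 : ℕ) : ℝ) := by exact_mod_cast hm
    push_cast at h
    exact h
  have hden : 0 < (L : ℝ) ^ 2 - (2 * m + 1) := by linarith
  have hsq1 : Real.sqrt ((L : ℝ) ^ 2 / ((L : ℝ) ^ 2 - ((m : ℝ) + m))) ≤
      Real.sqrt ((L : ℝ) ^ 2 / ((L : ℝ) ^ 2 - (2 * m + 1))) :=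
    Real.sqrt_le_sqrt (div_le_div_of_nonneg_left (sq_nonneg _) hden (by linarith))
  have hsq2 : Real.sqrt ((L : ℝ) ^ 2 / ((L : ℝ) ^ 2 - (((m + 1 : ℕ) : ℝ) + m))) ≤
      Real.sqrt ((L : ℝ) ^ 2 / ((L : ℝ) ^ 2 - (2 * m + 1))) :=
    Real.sqrt_le_sqrt (le_of_eq (by push_cast; ring_nf))
  have h72 : (0 : ℝ) ≤ 72 * |t| := by positivity
  have hsq1' := mul_le_mul_of_nonneg_left hsq1 h72
  have hsq2' := mul_le_mul_of_nonneg_left hsq2 h72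
  linarith

end Torus

/-- REGISTERED SUB-GOAL `stub_kineticPairWindow` (crux stmt-HubbardSuperconductivity-0933): the
`U`-independent kinetic bound on the pair chemical potential on the torus,
`E(2m+2,0) ≤ E(2m,0) + 144|t| (L²/(L²-2m-1))^{1/2}` (`minEnergyOn_szSector_add_two_le_kinetic`). [folklore] -/
theorem stub_kineticPairWindow : ∀ (L : ℕ) [NeZero L] (t U : ℝ) (m : ℕ), 2 * m + 2 ≤ L ^ 2 → (hubbardTorus 2 L t U).minEnergyOn (szSector (Λ := FermionTorus 2 L) (2 * m + 2) 0) ≤ (hubbardTorus 2 L t U).minEnergyOn (szSector (Λ := FermionTorus 2 L) (2 * m) 0) + 144 * |t| * Real.sqrt ((L : ℝ) ^ 2 / ((L : ℝ) ^ 2 - (2 * m + 1))) :=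
  fun L _ t U _ hm => minEnergyOn_szSector_add_two_le_kinetic L t U hm

end Summit.HubbardSuperconductivity.NoOnsiteODLRO.LargeU

end
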